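import Literature.NumberTheory.Transcendental.GammaIsoCrossProp112
import Literature.NumberTheory.Transcendental.ZilberPrimeModelIso
import Literature.NumberTheory.Transcendental.ZilberFieldGSGC
import HarnessLib

/-!
# Kirby 2010, Thm 2.1 across two Zilber fields: isomorphisms of countable closed subsets extend over closures

J. Kirby, *On quasiminimal excellent classes*, J. Symbolic Logic 75 (2010), Thm 2.1 (with
M. Bays, J. Kirby, *Excellence and uncountable categoricity of Zilber's exponential fields*
(2013), Props 4–5, and Bays–Kirby 2018, Thm 9.1), in the form needed ACROSS TWO Zilber fields
`K`, `K'` (of one universe) for Zilber's categoricity theorem: an isomorphism of exponential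
fields `g : ecl^K(S) ≅ ecl^{K'}(S')` between the closures of countable sets, together with
`a ↦ a'` for `a ∉ ecl S`, `a' ∉ ecl S'`, extends to an isomorphism
`ecl^K(S ∪ {a}) ≅ ecl^{K'}(S' ∪ {a'})` (`IsZilberField.eclIso_extension₂`). The one-field case is the
tree's `IsZilberField.eclIso_extension_holds` (`ZilberFieldQuasiminimalProofs.lean`); this file
re-runs that back-and-forth with the two fields kept apart:

* `IsEIsoOn₂ g A B` — `g : K → K'` restricts to an E-field isomorphism from `A ⊆ K` onto
  `B ⊆ K'` (two-field `ZilberHomogeneity.IsEIsoOn`), with `equiv`, `image_ecl`, `symm`, `restrict`;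
* `baseEquiv₂`, `isEBaseIso₂_baseEquiv₂` — the induced isomorphism of base Γ-fields
  `σ : (span ecl S)⁰ ≃ (span ecl S')⁰` (`GammaField.IsEBaseIso₂`);
* `exists_forth_tw₂`, `CoveredPair₂`, `CoveredPair₂.forth` — the forth step: a point of
  `H₁ = ecl(S, a)` lies in a finitely generated strong Γ-algebraic extension of the current strong
  base (`GammaField.exists_predim_le_zero_of_mem_ecl_coe` and minimisation of `δ`), realised in
  `K'` by the **cross-field twisted `ℵ₀`-saturation** `GammaField.isGammaIsoTw₂_saturation`
  (`GammaIsoCrossProp112.lean`: Bays–Kirby Prop. 11.2 over an isomorphism of Γ-closed bases of two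
  fields, from generic strong Γ-closedness of `K'` over `K₂`, `ZilberFieldGSGC.lean`), inside the
  Γ-closed `H₂ = ecl(S', a')`;
* `IsZilberField.eclIso_extension₂` — the theorem, by the two-structure back-and-forth
  `Literature.ModelTheory.Quasiminimal.exists_map_of_backAndForth₂` started at `(a) ↦ (a')`
  (`GammaField.IsGammaIsoTw₂.append_singleton_of_not_mem`).

This is the cross-field `ℵ₀`-homogeneity over countable closed subsets (uniqueness of the generic
type and extension over closures, in isomorphism form) of the class of Zilber fields
(Haykazyan 2016, Def. 2 (4), for `ZilberClass`; `ZilberClassAxioms.lean`). Everything is proved;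
no named fact is introduced.

## References

* J. Kirby, *On quasiminimal excellent classes*, J. Symbolic Logic 75 (2010) 551–564: Thm 2.1.
* M. Bays, J. Kirby, *Excellence and uncountable categoricity of Zilber's exponential fields*,
  arXiv:1305.0493 (2013): Lemma 3, Props 4–5.
* M. Bays, J. Kirby, *Pseudo-exponential maps, variants, and quasiminimality*, Algebra & Number
  Theory 12 (2018): Lemma 4.13, Prop. 11.2, Thm 9.1.
* L. Haykazyan, *Categoricity in quasiminimal pregeometry classes*, J. Symbolic Logic 81 (2016):
  Def. 2.
* B. Zilber, *Pseudo-exponentiation on algebraically closed fields of characteristic zero*,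
  Ann. Pure Appl. Logic 132 (2005): §5, Thm 5.13.
-/

noncomputable section

open Set MvPolynomial

universe u

namespace Literature.NumberTheory.Transcendental

/-! ### Isomorphisms between `ecl`-closed E-subfields of two fields, as maps `K → K'` -/

section EIso₂

variable {K : Type*} [Field K] [Literature.ModelTheory.ExponentialFields.ExponentialRing K]
variable {K' : Type*} [Field K'] [Literature.ModelTheory.ExponentialFields.ExponentialRing K']

/-- `IsEIsoOn₂ g A B`: the map `g : K → K'` restricts to an **isomorphism of exponential fields
from `A ⊆ K` onto `B ⊆ K'`** — a bijection `A → B` preserving `+`, `·` and `exp` on `A` (the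
two-field form of `IsEIsoOn`; used for `A = ecl S`, `B = ecl S'`, E-subfields by Kirby 2010
Lemma 3.3). These are the "isomorphisms between closed subsets" of two members of the class in
Kirby 2010 (quasiminimal excellent classes), axiom II and Thm 2.1, and Haykazyan 2016, Def. 2 (4).
[cite: Kirby2010QMEC, Def. 1.1 (axiom II) and Thm 2.1] [cite: Haykazyan2016, Definition 2] -/
structure IsEIsoOn₂ (g : K → K') (A : Set K) (B : Set K') : Prop where
  /-- `g` is a bijection from `A` onto `B`. -/
  bijOn : Set.BijOn g A B
  /-- `g` is additive on `A`. -/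
  map_add : ∀ ⦃u v : K⦄, u ∈ A → v ∈ A → g (u + v) = g u + g v
  /-- `g` is multiplicative on `A`. -/
  map_mul : ∀ ⦃u v : K⦄, u ∈ A → v ∈ A → g (u * v) = g u * g v
  /-- `g` commutes with `exp` on `A`. -/
  map_exp : ∀ ⦃u : K⦄, u ∈ A →
    g (Literature.ModelTheory.ExponentialFields.ExponentialRing.exp u) =
      Literature.ModelTheory.ExponentialFields.ExponentialRing.exp (g u)

/-- Inside one field, `IsEIsoOn₂` is `IsEIsoOn`. [folklore] -/
theorem isEIsoOn₂_iff_isEIsoOn {g : K → K} {A B : Set K} : IsEIsoOn₂ g A B ↔ IsEIsoOn g A B :=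
  ⟨fun h => ⟨h.bijOn, h.map_add, h.map_mul, h.map_exp⟩, fun h => ⟨h.bijOn, h.map_add, h.map_mul, h.map_exp⟩⟩

namespace IsEIsoOn₂

open Literature.ModelTheory.ExponentialFields.ExponentialRing

variable {g : K → K'} {S : Set K} {S' : Set K'}

/-- An E-isomorphism `ecl S ≅ ecl S'` maps `0` to `0`. [folklore] -/
theorem map_zero (h : IsEIsoOn₂ g (ecl S) (ecl S')) : g 0 = 0 := by
  have h0 := h.map_add (Khovanskii.zero_mem_ecl S) (Khovanskii.zero_mem_ecl S)
  rw [add_zero] at h0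
  have : g 0 + g 0 = g 0 + 0 := by rw [add_zero]; exact h0.symm
  exact add_left_cancel this

/-- An E-isomorphism `ecl S ≅ ecl S'` maps `1` to `1`. [folklore] -/
theorem map_one (h : IsEIsoOn₂ g (ecl S) (ecl S')) : g 1 = 1 := by
  have h1 := h.map_mul (Khovanskii.one_mem_ecl S) (Khovanskii.one_mem_ecl S)
  rw [mul_one] at h1
  by_cases h0 : g 1 = 0
  · exfalso
    have : (1 : K) = 0 := h.bijOn.injOn (Khovanskii.one_mem_ecl S) (Khovanskii.zero_mem_ecl S)
      (h0.trans h.map_zero.symm)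
    exact one_ne_zero this
  · exact mul_left_cancel₀ h0 (h1.symm.trans (mul_one (g 1)).symm)

/-- An E-isomorphism `ecl S ≅ ecl S'` is compatible with negation. [folklore] -/
theorem map_neg (h : IsEIsoOn₂ g (ecl S) (ecl S')) {u : K} (hu : u ∈ ecl S) : g (-u) = -g u := by
  have := h.map_add hu (Khovanskii.neg_mem_ecl hu)
  rw [add_neg_cancel, h.map_zero] at this
  exact (neg_eq_of_add_eq_zero_right this.symm).symm

/-- The bundled form: an E-isomorphism `ecl S ≅ ecl S'` as an `ExponentialRingEquiv` between the
E-subfields `eclSubfield S ≤ K` and `eclSubfield S' ≤ K'`. [folklore] -/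
def equiv (h : IsEIsoOn₂ g (ecl S) (ecl S')) :
    ExponentialRingEquiv (Khovanskii.eclSubfield S) (Khovanskii.eclSubfield S') where
  toFun a := ⟨g a, h.bijOn.mapsTo a.2⟩
  invFun b := ⟨Function.invFunOn g (ecl S) b, h.bijOn.surjOn.mapsTo_invFunOn b.2⟩
  left_inv a := Subtype.ext (h.bijOn.invOn_invFunOn.1 a.2)
  right_inv b := Subtype.ext (h.bijOn.invOn_invFunOn.2 b.2)
  map_mul' a b := Subtype.ext (h.map_mul a.2 b.2)
  map_add' a b := Subtype.ext (h.map_add a.2 b.2)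
  map_exp' a := Subtype.ext (h.map_exp a.2)

/-- The bundled isomorphism is `g` on coordinates. [folklore] -/
@[simp] theorem coe_equiv_apply (h : IsEIsoOn₂ g (ecl S) (ecl S')) (a : Khovanskii.eclSubfield S) :
    (h.equiv a : K') = g a := rfl

/-- **An E-isomorphism `g : ecl S ≅ ecl S'` carries `ecl T` onto `ecl (g T)` for every
`T ⊆ ecl S`** (closures are invariants of the E-field structure and may be computed inside the
`ecl`-closed E-subfields, `Khovanskii.eclSubfield.image_ecl`). [cite: Kirby2010QMEC, Lemma 1.3] -/
theorem image_ecl (h : IsEIsoOn₂ g (ecl S) (ecl S')) {T : Set K} (hT : T ⊆ ecl S) :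
    g '' ecl T = ecl (g '' T) := by
  set T₀ : Set (Khovanskii.eclSubfield S) := ((↑) : Khovanskii.eclSubfield S → K) ⁻¹' T with hT₀
  have hTT₀ : ((↑) : Khovanskii.eclSubfield S → K) '' T₀ = T :=
    IsEIsoOn.image_preimage_coe_of_subset hT
  have hcomp : g ∘ ((↑) : Khovanskii.eclSubfield S → K) =
      ((↑) : Khovanskii.eclSubfield S' → K') ∘ h.equiv := funext fun a => rfl
  calc g '' ecl T = g '' (((↑) : Khovanskii.eclSubfield S → K) '' ecl T₀) := by
          rw [Khovanskii.eclSubfield.image_ecl S T₀, hTT₀]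
    _ = ((↑) : Khovanskii.eclSubfield S' → K') '' (h.equiv '' ecl T₀) := by
          rw [Set.image_image, Set.image_image]; rfl
    _ = ((↑) : Khovanskii.eclSubfield S' → K') '' ecl (h.equiv '' T₀) := by
          rw [Khovanskii.image_ecl_equiv]
    _ = ecl (((↑) : Khovanskii.eclSubfield S' → K') '' (h.equiv '' T₀)) :=
          Khovanskii.eclSubfield.image_ecl S' _
    _ = ecl (g '' T) := by
          rw [Set.image_image, ← hTT₀, Set.image_image]; rfl

/-- The inverse of an E-isomorphism `ecl S ≅ ecl S'` (as the map `Function.invFunOn g (ecl S)`) is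
an E-isomorphism `ecl S' ≅ ecl S`. [folklore] -/
protected theorem symm (h : IsEIsoOn₂ g (ecl S) (ecl S')) :
    IsEIsoOn₂ (Function.invFunOn g (ecl S)) (ecl S') (ecl S) := by
  have hinv := h.bijOn.invOn_invFunOn
  refine ⟨hinv.symm.bijOn h.bijOn.surjOn.mapsTo_invFunOn h.bijOn.mapsTo, ?_, ?_, ?_⟩
  · intro u v hu hv
    obtain ⟨a, ha, rfl⟩ := h.bijOn.surjOn hu
    obtain ⟨b, hb, rfl⟩ := h.bijOn.surjOn hv
    rw [← h.map_add ha hb, hinv.1 ha, hinv.1 hb, hinv.1 (Khovanskii.add_mem_ecl ha hb)]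
  · intro u v hu hv
    obtain ⟨a, ha, rfl⟩ := h.bijOn.surjOn hu
    obtain ⟨b, hb, rfl⟩ := h.bijOn.surjOn hv
    rw [← h.map_mul ha hb, hinv.1 ha, hinv.1 hb, hinv.1 (Khovanskii.mul_mem_ecl ha hb)]
  · intro u hu
    obtain ⟨a, ha, rfl⟩ := h.bijOn.surjOn hu
    rw [← h.map_exp ha, hinv.1 ha, hinv.1 (Khovanskii.exp_mem_ecl ha)]

/-- The inverse E-isomorphism inverts `g` on `ecl S`. [folklore] -/
theorem symm_apply_apply (h : IsEIsoOn₂ g (ecl S) (ecl S')) {u : K} (hu : u ∈ ecl S) :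
    Function.invFunOn g (ecl S) (g u) = u :=
  h.bijOn.invOn_invFunOn.1 hu

/-- Restriction of an E-isomorphism `ecl S ≅ ecl S'` to the closure of a subset `T ⊆ ecl S`: an
E-isomorphism `ecl T ≅ ecl (g T)`. [folklore] -/
theorem restrict (h : IsEIsoOn₂ g (ecl S) (ecl S')) {T : Set K} (hT : T ⊆ ecl S) :
    IsEIsoOn₂ g (ecl T) (ecl (g '' T)) := by
  have hsub : ecl T ⊆ ecl S := by
    have := ecl_mono (K := K) hT
    rwa [Khovanskii.ecl_ecl] at this
  refine ⟨?_, fun u v hu hv => h.map_add (hsub hu) (hsub hv),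
    fun u v hu hv => h.map_mul (hsub hu) (hsub hv), fun u hu => h.map_exp (hsub hu)⟩
  rw [← h.image_ecl hT]
  exact h.bijOn.subset_left hsub

/-- Changing the map off `ecl S`. [folklore] -/
theorem congr (h : IsEIsoOn₂ g (ecl S) (ecl S')) {g₁ : K → K'} (hg₁ : EqOn g₁ g (ecl S)) :
    IsEIsoOn₂ g₁ (ecl S) (ecl S') := by
  refine ⟨h.bijOn.congr hg₁.symm, fun u v hu hv => ?_, fun u v hu hv => ?_, fun u hu => ?_⟩
  · rw [hg₁ (Khovanskii.add_mem_ecl hu hv), hg₁ hu, hg₁ hv]; exact h.map_add hu hv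
  · rw [hg₁ (Khovanskii.mul_mem_ecl hu hv), hg₁ hu, hg₁ hv]; exact h.map_mul hu hv
  · rw [hg₁ (Khovanskii.exp_mem_ecl hu), hg₁ hu]; exact h.map_exp hu

end IsEIsoOn₂

end EIso₂

namespace ZilberHomogeneity

open GammaField Literature.ModelTheory.ExponentialFields.ExponentialRing
  Literature.ModelTheory.Quasiminimal ZilberPrimeModel

variable {K : Type u} [Field K] [CharZero K] [Literature.ModelTheory.ExponentialFields.ExponentialRing K]
variable {K' : Type u} [Field K'] [CharZero K'] [Literature.ModelTheory.ExponentialFields.ExponentialRing K']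

/-! ### The base isomorphism induced by an E-isomorphism of closed sets of two fields -/

/-- **The isomorphism of base Γ-fields induced by an E-isomorphism `g : ecl S ≅ ecl S'` between
closed subsets of two fields**: `σ = g` on `fieldOf (span (ecl S)) = ecl S`.
[cite: Kirby2010QMEC, Thm 2.1 (proof)] -/
def baseEquiv₂ {g : K → K'} {S : Set K} {S' : Set K'} (hg : IsEIsoOn₂ g (ecl S) (ecl S')) :
    fieldOf (Submodule.span ℚ (ecl S)) ≃+* fieldOf (Submodule.span ℚ (ecl S')) where
  toFun x := ⟨g x, (mem_fieldOf_span_ecl_iff S').2 (hg.bijOn.mapsTo ((mem_fieldOf_span_ecl_iff S).1 x.2))⟩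
  invFun y := ⟨Function.invFunOn g (ecl S) y,
    (mem_fieldOf_span_ecl_iff S).2 (hg.bijOn.surjOn.mapsTo_invFunOn ((mem_fieldOf_span_ecl_iff S').1 y.2))⟩
  left_inv x := Subtype.ext (hg.symm_apply_apply ((mem_fieldOf_span_ecl_iff S).1 x.2))
  right_inv y := Subtype.ext (hg.bijOn.invOn_invFunOn.2 ((mem_fieldOf_span_ecl_iff S').1 y.2))
  map_mul' x y := Subtype.ext (hg.map_mul ((mem_fieldOf_span_ecl_iff S).1 x.2) ((mem_fieldOf_span_ecl_iff S).1 y.2))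
  map_add' x y := Subtype.ext (hg.map_add ((mem_fieldOf_span_ecl_iff S).1 x.2) ((mem_fieldOf_span_ecl_iff S).1 y.2))

/-- `baseEquiv₂` is `g` on underlying elements. [folklore] -/
@[simp] theorem coe_baseEquiv₂ {g : K → K'} {S : Set K} {S' : Set K'} (hg : IsEIsoOn₂ g (ecl S) (ecl S'))
    (x : fieldOf (Submodule.span ℚ (ecl S))) : (baseEquiv₂ hg x : K') = g x := rfl

/-- `baseEquiv₂` is an isomorphism of base Γ-fields (`g` maps `ecl S` onto `ecl S'` and commutes
with `exp`). [cite: Kirby2010QMEC, Thm 2.1 (proof)] -/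
theorem isEBaseIso₂_baseEquiv₂ {g : K → K'} {S : Set K} {S' : Set K'} (hg : IsEIsoOn₂ g (ecl S) (ecl S')) :
    IsEBaseIso₂ (Submodule.span ℚ (ecl S)) (Submodule.span ℚ (ecl S')) (baseEquiv₂ hg) where
  map_mem {x} hx := by
    rw [← SetLike.mem_coe, coe_span_ecl] at hx ⊢
    change g x ∈ ecl S'
    exact hg.bijOn.mapsTo hx
  symm_map_mem {y} hy := by
    rw [← SetLike.mem_coe, coe_span_ecl] at hy ⊢
    change Function.invFunOn g (ecl S) y ∈ ecl S
    exact hg.bijOn.surjOn.mapsTo_invFunOn hy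
  map_exp {x} hx := by
    rw [← SetLike.mem_coe, coe_span_ecl] at hx
    change g (exp x) = exp (g x)
    exact hg.map_exp hx

/-! ### Forth: realising one more point over a cross Γ-isomorphism -/

/-- **Forth step of the back-and-forth, across two fields** (Kirby 2010, proof of Thm 2.1;
Bays–Kirby 2013, proof of Prop. 5). Let `K₁ ≤ K` be Γ-closed, `K'` algebraically closed with
`exp` onto its units and generically strongly Γ-closed over `K₂ ≤ K'`, `σ` an isomorphism of the
base Γ-fields, `H₁ ⊇ K₁`, `H₂ ⊇ K₂` Γ-closed subspaces of `K`, `K'`, and `c ↦ c'` a cross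
Γ-isomorphism over `σ` with `K₁ + ℚc ◁ K`, `K₂ + ℚc' ◁ K'`, `c ⊆ H₁`, `c' ⊆ H₂`. Then every
`d ∈ ecl(K₁ + ℚc)` is the first coordinate of a tuple `e ⊆ H₁` such that `(c, e) ↦ (c', e')` is a
cross Γ-isomorphism over `σ` for some `e' ⊆ H₂`, with both extended spans strong: `d` lies in a
finitely generated strong `E ⊇ K₁ + ℚc` of predimension `0`, which the cross twisted
`ℵ₀`-saturation `GammaField.isGammaIsoTw₂_saturation` realises in `K'` with strong image of
predimension `0`, hence inside `H₂`. [cite: Kirby2010QMEC, Thm 2.1 (proof)] [cite: BaysKirby2013Excellence, Prop. 5 (proof)] -/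
theorem exists_forth_tw₂ [IsAlgClosed K] [IsAlgClosed K'] (hsurj : IsSurjectiveOntoUnits K')
    {K₁ : Submodule ℚ K} {K₂ : Submodule ℚ K'} {σ : fieldOf K₁ ≃+* fieldOf K₂} (hσ : IsEBaseIso₂ K₁ K₂ σ)
    (hK₁ : IsGammaClosed K₁) (hG : IsGenericallyStronglyGammaClosedOver K₂)
    {H₁ : Submodule ℚ K} {H₂ : Submodule ℚ K'} (hH₁ : IsGammaClosed H₁) (hH₂ : IsGammaClosed H₂)
    (hKH₁ : K₁ ≤ H₁) (hKH₂ : K₂ ≤ H₂) {m : ℕ} {c : Fin m → K} {c' : Fin m → K'} (hiso : IsGammaIsoTw₂ σ c c')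
    (hs : IsStrong (K₁ ⊔ Submodule.span ℚ (range c))) (hs' : IsStrong (K₂ ⊔ Submodule.span ℚ (range c')))
    (hcH : ∀ i, c i ∈ H₁) (hc'H : ∀ i, c' i ∈ H₂) {d : K}
    (hd : d ∈ ecl ((K₁ ⊔ Submodule.span ℚ (range c) : Submodule ℚ K) : Set K)) :
    ∃ (k : ℕ) (e : Fin (k + 1) → K) (e' : Fin (k + 1) → K'), e 0 = d ∧
      IsGammaIsoTw₂ σ (Fin.append c e) (Fin.append c' e') ∧
      IsStrong (K₁ ⊔ Submodule.span ℚ (range (Fin.append c e))) ∧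
      IsStrong (K₂ ⊔ Submodule.span ℚ (range (Fin.append c' e'))) ∧
      (∀ i, e i ∈ H₁) ∧ (∀ i, e' i ∈ H₂) := by
  classical
  set D := K₁ ⊔ Submodule.span ℚ (range c) with hDdef
  have hDH : D ≤ H₁ := sup_le hKH₁ (Submodule.span_le.2 (by rintro _ ⟨i, rfl⟩; exact hcH i))
  have hD'H : K₂ ⊔ Submodule.span ℚ (range c') ≤ H₂ :=
    sup_le hKH₂ (Submodule.span_le.2 (by rintro _ ⟨i, rfl⟩; exact hc'H i))
  obtain ⟨n₀, x₀, ⟨i₀, hi₀⟩, hδ₀⟩ := exists_predim_le_zero_of_mem_ecl_coe D hd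
  have hfgd : IsFG D (D ⊔ Submodule.span ℚ {d}) := isFG_sup_left.2 (isFG_span_of_finite D (finite_singleton d))
  obtain ⟨E, hdE, hfgE, -, hmin⟩ := hs.exists_forall_predim_le (fun _ => True) le_sup_left hfgd trivial
  have hDE : D ≤ E := le_sup_left.trans hdE
  have hdmem : d ∈ E := hdE (Submodule.mem_sup_right (Submodule.mem_span_singleton_self d))
  have hEstrong : IsStrong E :=
    isStrong_of_forall_predim_le hDE hfgE fun X hX hfgX => hmin X (hdE.trans hX) hfgX trivial
  have hδE : predim D E = 0 := by
    refine le_antisymm ?_ (isStrong_iff.1 hs E hfgE)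
    have h1 := hmin (D ⊔ Submodule.span ℚ (range x₀))
      (sup_le le_sup_left ((Submodule.span_singleton_le_iff_mem _ _).2
        (Submodule.mem_sup_right (Submodule.subset_span ⟨i₀, hi₀⟩))))
      (isFG_sup_left.2 (isFG_span_of_finite D (finite_range x₀))) trivial
    rw [predim_sup_left] at h1
    exact h1.trans hδ₀
  obtain ⟨s, hsE, hEle⟩ := isFG_iff_exists_finset.1 hfgE
  set e : Fin (s.card + 1) → K := Fin.cons d fun i => (s.equivFin.symm i : K) with he
  have he0 : e 0 = d := rfl
  have heE : ∀ i, e i ∈ E := by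
    intro i
    refine Fin.cases ?_ (fun j => ?_) i
    · exact hdmem
    · simp only [he, Fin.cons_succ]
      exact hsE (s.equivFin.symm j).2
  have hDe : D ⊔ Submodule.span ℚ (range e) = E := by
    refine le_antisymm (sup_le hDE (Submodule.span_le.2 (by rintro _ ⟨i, rfl⟩; exact heE i))) ?_
    refine hEle.trans (sup_le le_sup_left ((Submodule.span_mono ?_).trans le_sup_right))
    intro z hz
    refine ⟨Fin.succ (s.equivFin ⟨z, hz⟩), ?_⟩
    simp [he]
  have hδe : predim D (Submodule.span ℚ (range e)) = 0 := by
    rw [← predim_sup_left, hDe]; exact hδE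
  obtain ⟨e', hγ, hstr', hδ'⟩ := isGammaIsoTw₂_saturation hsurj hK₁ hG hσ hs hs' hiso hδe
  have hrange : K₁ ⊔ Submodule.span ℚ (range (Fin.append c e)) = E := by
    rw [ZilberHomogeneity.range_append, Submodule.span_union, ← sup_assoc, ← hDdef, hDe]
  refine ⟨s.card, e, e', he0, hγ, by rw [hrange]; exact hEstrong, hstr', fun i => ?_, fun i => ?_⟩
  · have hEH : E ≤ H₁ := le_of_predim_le_zero_of_isGammaClosed hs hH₁ hDH hDE hfgE hδE.le
    exact hEH (heE i)
  · have hfg' : IsFG (K₂ ⊔ Submodule.span ℚ (range c'))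
        ((K₂ ⊔ Submodule.span ℚ (range c')) ⊔ Submodule.span ℚ (range e')) :=
      isFG_sup_left.2 (isFG_span_of_finite _ (finite_range e'))
    have hE'H : (K₂ ⊔ Submodule.span ℚ (range c')) ⊔ Submodule.span ℚ (range e') ≤ H₂ :=
      le_of_predim_le_zero_of_isGammaClosed hs' hH₂ hD'H le_sup_left hfg'
        (by rw [predim_sup_left]; exact hδ'.le)
    exact hE'H (Submodule.mem_sup_right (Submodule.subset_span ⟨i, rfl⟩))

/-! ### The covering relation with a distinguished tuple, across two fields -/

/-- **The back-and-forth relation across two fields, with a distinguished tuple**: the finite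
tuples `x` (from `K`), `y` (from `K'`) are covered by a cross Γ-isomorphism `c ↦ c'` over `σ`
between tuples from `H₁`, `H₂` spanning strong subspaces, which also covers `a ↦ a'`. (Two-field
form of `ZilberHomogeneity.Covered`.) [cite: Kirby2010QMEC, Thm 2.1 (proof)] -/
def CoveredTuple₂ {K₁ : Submodule ℚ K} {K₂ : Submodule ℚ K'} (σ : fieldOf K₁ ≃+* fieldOf K₂)
    (H₁ : Submodule ℚ K) (H₂ : Submodule ℚ K') {k : ℕ} (a : Fin k → K) (a' : Fin k → K') (n : ℕ)
    (x : Fin n → K) (y : Fin n → K') : Prop :=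
  ∃ (m : ℕ) (c : Fin m → K) (c' : Fin m → K'), IsGammaIsoTw₂ σ c c' ∧
    IsStrong (K₁ ⊔ Submodule.span ℚ (range c)) ∧ IsStrong (K₂ ⊔ Submodule.span ℚ (range c')) ∧
    (∀ i, c i ∈ H₁) ∧ (∀ i, c' i ∈ H₂) ∧ (∀ l, ∃ i, c i = a l ∧ c' i = a' l) ∧
    ∀ j, ∃ i, c i = x j ∧ c' i = y j

/-- Unfolding lemma for `CoveredTuple₂`. [folklore] -/
theorem coveredTuple₂_iff {K₁ : Submodule ℚ K} {K₂ : Submodule ℚ K'} {σ : fieldOf K₁ ≃+* fieldOf K₂}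
    {H₁ : Submodule ℚ K} {H₂ : Submodule ℚ K'} {k : ℕ} {a : Fin k → K} {a' : Fin k → K'} {n : ℕ}
    {x : Fin n → K} {y : Fin n → K'} :
    CoveredTuple₂ σ H₁ H₂ a a' n x y ↔
      ∃ (m : ℕ) (c : Fin m → K) (c' : Fin m → K'), IsGammaIsoTw₂ σ c c' ∧
        IsStrong (K₁ ⊔ Submodule.span ℚ (range c)) ∧ IsStrong (K₂ ⊔ Submodule.span ℚ (range c')) ∧
        (∀ i, c i ∈ H₁) ∧ (∀ i, c' i ∈ H₂) ∧ (∀ l, ∃ i, c i = a l ∧ c' i = a' l) ∧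
        ∀ j, ∃ i, c i = x j ∧ c' i = y j := Iff.rfl

/-- Symmetry of the covering relation (invert the cross Γ-isomorphism). [folklore] -/
theorem CoveredTuple₂.symm {K₁ : Submodule ℚ K} {K₂ : Submodule ℚ K'} {σ : fieldOf K₁ ≃+* fieldOf K₂}
    {H₁ : Submodule ℚ K} {H₂ : Submodule ℚ K'} {k : ℕ} {a : Fin k → K} {a' : Fin k → K'} {n : ℕ}
    {x : Fin n → K} {y : Fin n → K'}
    (h : CoveredTuple₂ σ H₁ H₂ a a' n x y) : CoveredTuple₂ σ.symm H₂ H₁ a' a n y x := by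
  obtain ⟨m, c, c', hiso, hs, hs', hcH, hc'H, hia, hcov⟩ := h
  exact ⟨m, c', c, hiso.symm, hs', hs, hc'H, hcH, fun l => let ⟨i, hi, hi'⟩ := hia l; ⟨i, hi', hi⟩,
    fun j => let ⟨i, hi, hi'⟩ := hcov j; ⟨i, hi', hi⟩⟩

/-- Related tuples have the same pattern of equal coordinates. [folklore] -/
theorem CoveredTuple₂.apply_eq_iff {K₁ : Submodule ℚ K} {K₂ : Submodule ℚ K'} {σ : fieldOf K₁ ≃+* fieldOf K₂}
    {H₁ : Submodule ℚ K} {H₂ : Submodule ℚ K'} {k : ℕ} {a : Fin k → K} {a' : Fin k → K'} {n : ℕ}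
    {x : Fin n → K} {y : Fin n → K'}
    (h : CoveredTuple₂ σ H₁ H₂ a a' n x y) (i j : Fin n) : x i = x j ↔ y i = y j := by
  obtain ⟨m, c, c', hiso, -, -, -, -, -, hcov⟩ := h
  obtain ⟨p, hp, hp'⟩ := hcov i
  obtain ⟨q, hq, hq'⟩ := hcov j
  rw [← hp, ← hq, ← hp', ← hq']
  exact hiso.apply_eq_iff p q

/-- **Forth for the covering relation, across two fields**: a covered pair extends by any point of
`H₁` on the left, with a partner in `H₂`. [cite: Kirby2010QMEC, Thm 2.1 (proof)] -/
theorem CoveredTuple₂.forth [IsAlgClosed K] [IsAlgClosed K'] (hsurj : IsSurjectiveOntoUnits K')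
    {K₁ : Submodule ℚ K} {K₂ : Submodule ℚ K'} {σ : fieldOf K₁ ≃+* fieldOf K₂} (hσ : IsEBaseIso₂ K₁ K₂ σ)
    (hK₁ : IsGammaClosed K₁) (hG : IsGenericallyStronglyGammaClosedOver K₂)
    {H₁ : Submodule ℚ K} {H₂ : Submodule ℚ K'} (hH₁ : IsGammaClosed H₁) (hH₂ : IsGammaClosed H₂)
    (hKH₁ : K₁ ≤ H₁) (hKH₂ : K₂ ≤ H₂) {k : ℕ} {a : Fin k → K} {a' : Fin k → K'}
    (hHa : (H₁ : Set K) ⊆ ecl (range a ∪ (K₁ : Set K)))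
    {n : ℕ} {x : Fin n → K} {y : Fin n → K'} (h : CoveredTuple₂ σ H₁ H₂ a a' n x y) {d : K} (hd : d ∈ H₁) :
    ∃ d' ∈ H₂, CoveredTuple₂ σ H₁ H₂ a a' (n + 1) (Fin.snoc x d) (Fin.snoc y d') := by
  obtain ⟨m, c, c', hiso, hs, hs', hcH, hc'H, hia, hcov⟩ := h
  have hsub : range a ∪ (K₁ : Set K) ⊆ ((K₁ ⊔ Submodule.span ℚ (range c) : Submodule ℚ K) : Set K) := by
    refine union_subset ?_ fun z hz => Submodule.mem_sup_left hz
    rintro _ ⟨l, rfl⟩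
    obtain ⟨i, hi, -⟩ := hia l
    rw [← hi]
    exact Submodule.mem_sup_right (Submodule.subset_span ⟨i, rfl⟩)
  have hd' : d ∈ ecl ((K₁ ⊔ Submodule.span ℚ (range c) : Submodule ℚ K) : Set K) :=
    ecl_mono hsub (hHa hd)
  obtain ⟨k', e, e', he0, hγ, hse, hse', heH, he'H⟩ :=
    exists_forth_tw₂ hsurj hσ hK₁ hG hH₁ hH₂ hKH₁ hKH₂ hiso hs hs' hcH hc'H hd'
  refine ⟨e' 0, he'H 0, m + (k' + 1), Fin.append c e, Fin.append c' e', hγ, hse, hse', ?_, ?_, ?_, ?_⟩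
  · intro i
    refine Fin.addCases (fun j => ?_) (fun j => ?_) i
    · simpa only [Fin.append_left] using hcH j
    · simpa only [Fin.append_right] using heH j
  · intro i
    refine Fin.addCases (fun j => ?_) (fun j => ?_) i
    · simpa only [Fin.append_left] using hc'H j
    · simpa only [Fin.append_right] using he'H j
  · intro l
    obtain ⟨i, hi, hi'⟩ := hia l
    exact ⟨Fin.castAdd (k' + 1) i, by simp [hi], by simp [hi']⟩
  · intro j
    refine Fin.lastCases ?_ (fun j' => ?_) j
    · exact ⟨Fin.natAdd m 0, by simp [he0], by simp⟩
    · obtain ⟨i, hi, hi'⟩ := hcov j'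
      exact ⟨Fin.castAdd (k' + 1) i, by simp [hi], by simp [hi']⟩

/-! ### The theorems -/

set_option maxHeartbeats 800000 in
/-- **Isomorphisms of countable closed subsets of two Zilber fields extend over strong Γ-isomorphic
tuples** (Kirby 2010, Thm 2.1, generalised starting point): for Zilber fields `K`, `K'`, a countable
`S ⊆ K`, an isomorphism of exponential fields `g : ecl^K(S) ≅ ecl^{K'}(S')` with induced base
isomorphism `σ` (`baseEquiv₂`), and tuples `c`, `c'` with `c ↦ c'` a cross Γ-isomorphism over `σ`
and `span (ecl S) + ℚc ◁ K`, `span (ecl S') + ℚc' ◁ K'`, the map `g ∪ (c ↦ c')` extends to an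
isomorphism of exponential fields `ecl^K(S ∪ c) ≅ ecl^{K'}(S' ∪ c')`. Proof: two-structure countable
back-and-forth (`Literature.ModelTheory.Quasiminimal.exists_map_of_backAndForth₂`) through
`CoveredTuple₂`, started at `c ↦ c'` and extended by `CoveredTuple₂.forth` on both sides (cross
twisted `ℵ₀`-saturation `GammaField.isGammaIsoTw₂_saturation`, from generic strong Γ-closedness of
Zilber fields); the limit preserves `+`, `·`, `exp`, is `g` on `ecl S` and sends `c ↦ c'`.
[cite: Kirby2010QMEC, Thm 2.1] [cite: BaysKirby2013Excellence, Lemma 3 and Prop. 5]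
[cite: BaysKirby2018ANT, Thm 9.1, Prop. 11.2] -/
theorem exists_isEIsoOn₂_of_isGammaIsoTw₂ (hK : IsZilberField K) (hK' : IsZilberField K')
    {S : Set K} {S' : Set K'} (hS : S.Countable) {g : K → K'} (hg : IsEIsoOn₂ g (ecl S) (ecl S'))
    {k : ℕ} {a : Fin k → K} {a' : Fin k → K'} (ha : IsGammaIsoTw₂ (baseEquiv₂ hg) a a')
    (hsa : IsStrong (Submodule.span ℚ (ecl S) ⊔ Submodule.span ℚ (range a)))
    (hsa' : IsStrong (Submodule.span ℚ (ecl S') ⊔ Submodule.span ℚ (range a'))) :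
    ∃ g' : K → K', IsEIsoOn₂ g' (ecl (S ∪ range a)) (ecl (S' ∪ range a')) ∧
      EqOn g' g (ecl S) ∧ ∀ l, g' (a l) = a' l := by
  classical
  haveI := hK.isAlgClosed
  haveI := hK'.isAlgClosed
  have hsurj := hK.isSurjectiveOntoUnits
  have hsurj' := hK'.isSurjectiveOntoUnits
  have hccp := hK.hasCountableClosureProperty
  have hccp' := hK'.hasCountableClosureProperty
  -- the bases and the closures
  set K₁ : Submodule ℚ K := Submodule.span ℚ (ecl S) with hK₁def
  set K₂ : Submodule ℚ K' := Submodule.span ℚ (ecl S') with hK₂def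
  set H₁ : Submodule ℚ K := Submodule.span ℚ (ecl (S ∪ range a)) with hH₁def
  set H₂ : Submodule ℚ K' := Submodule.span ℚ (ecl (S' ∪ range a')) with hH₂def
  have hK₁ : IsGammaClosed K₁ := isGammaClosed_span_ecl_univ _
  have hK₂ : IsGammaClosed K₂ := isGammaClosed_span_ecl_univ _
  have hH₁ : IsGammaClosed H₁ := isGammaClosed_span_ecl_univ _
  have hH₂ : IsGammaClosed H₂ := isGammaClosed_span_ecl_univ _
  have hG₁ : IsGenericallyStronglyGammaClosedOver K₁ :=
    ZilberGSGC.isGenericallyStronglyGammaClosedOver_of_isStronglyExpAlgClosed hK.isStronglyExpAlgClosed K₁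
  have hG₂ : IsGenericallyStronglyGammaClosedOver K₂ :=
    ZilberGSGC.isGenericallyStronglyGammaClosedOver_of_isStronglyExpAlgClosed hK'.isStronglyExpAlgClosed K₂
  have hmemK₁ : ∀ {z : K}, z ∈ K₁ ↔ z ∈ ecl S := fun {z} => by
    rw [← SetLike.mem_coe, hK₁def, coe_span_ecl]
  have hmemK₂ : ∀ {z : K'}, z ∈ K₂ ↔ z ∈ ecl S' := fun {z} => by
    rw [← SetLike.mem_coe, hK₂def, coe_span_ecl]
  have hmemH₁ : ∀ {z : K}, z ∈ H₁ ↔ z ∈ ecl (S ∪ range a) := fun {z} => by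
    rw [← SetLike.mem_coe, hH₁def, coe_span_ecl]
  have hmemH₂ : ∀ {z : K'}, z ∈ H₂ ↔ z ∈ ecl (S' ∪ range a') := fun {z} => by
    rw [← SetLike.mem_coe, hH₂def, coe_span_ecl]
  have hKH₁ : K₁ ≤ H₁ := fun z hz => hmemH₁.2 (ecl_mono subset_union_left (hmemK₁.1 hz))
  have hKH₂ : K₂ ≤ H₂ := fun z hz => hmemH₂.2 (ecl_mono subset_union_left (hmemK₂.1 hz))
  have haH₁ : ∀ l, a l ∈ H₁ := fun l => hmemH₁.2 (subset_ecl _ (Or.inr ⟨l, rfl⟩))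
  have haH₂ : ∀ l, a' l ∈ H₂ := fun l => hmemH₂.2 (subset_ecl _ (Or.inr ⟨l, rfl⟩))
  have hHa₁ : (H₁ : Set K) ⊆ ecl (range a ∪ (K₁ : Set K)) := by
    intro z hz
    rw [SetLike.mem_coe, hmemH₁] at hz
    refine ecl_mono (union_subset (fun w hw => Or.inr ?_) subset_union_left) hz
    rw [SetLike.mem_coe, hmemK₁]; exact subset_ecl _ hw
  have hHa₂ : (H₂ : Set K') ⊆ ecl (range a' ∪ (K₂ : Set K')) := by
    intro z hz
    rw [SetLike.mem_coe, hmemH₂] at hz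
    refine ecl_mono (union_subset (fun w hw => Or.inr ?_) subset_union_left) hz
    rw [SetLike.mem_coe, hmemK₂]; exact subset_ecl _ hw
  -- the base isomorphism
  set σ := baseEquiv₂ hg with hσdef
  have hσ : IsEBaseIso₂ K₁ K₂ σ := isEBaseIso₂_baseEquiv₂ hg
  -- the starting pair `a ↦ a'`
  have hstart : CoveredTuple₂ σ H₁ H₂ a a' 0 Fin.elim0 Fin.elim0 :=
    ⟨k, a, a', ha, hsa, hsa', haH₁, haH₂, fun l => ⟨l, rfl, rfl⟩, fun j => j.elim0⟩
  -- countability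
  have hSecl : (ecl S).Countable := hccp S hS
  have hS'ecl : (ecl S').Countable := by
    rw [← hg.bijOn.image_eq]; exact hSecl.image g
  have hC₁ : ((H₁ : Set K)).Countable := countable_span_ecl hccp (hS.union (countable_range a))
  have hC₂ : ((H₂ : Set K')).Countable := by
    have h1 : ecl (S' ∪ range a') = ecl (ecl S' ∪ range a') := by
      refine Subset.antisymm (ecl_mono (union_subset_union_left _ (subset_ecl _))) ?_
      have : ecl (ecl S' ∪ range a') ⊆ ecl (ecl (S' ∪ range a')) :=
        ecl_mono (union_subset (ecl_mono subset_union_left) ((subset_union_right).trans (subset_ecl _)))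
      rwa [Khovanskii.ecl_ecl] at this
    rw [hH₂def, coe_span_ecl, h1]
    exact hccp' _ (hS'ecl.union (countable_range a'))
  -- the back-and-forth
  obtain ⟨g', himg, hcov⟩ := exists_map_of_backAndForth₂ (M := K) (N := K')
    (S := fun n x y => CoveredTuple₂ σ H₁ H₂ a a' n x y) (C := (H₁ : Set K)) (C' := (H₂ : Set K')) hC₁ hC₂
    hstart (fun n x y h i j => h.apply_eq_iff i j)
    (fun n x y h _ _ d hd => CoveredTuple₂.forth hsurj' hσ hK₁ hG₂ hH₁ hH₂ hKH₁ hKH₂ hHa₁ h hd)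
    (fun n x y h _ _ d hd => by
      obtain ⟨d₀, hd₀, hcov⟩ := CoveredTuple₂.forth hsurj hσ.symm hK₂ hG₁ hH₂ hH₁ hKH₂ hKH₁ hHa₂ h.symm hd
      refine ⟨d₀, hd₀, ?_⟩
      have := hcov.symm
      rwa [RingEquiv.symm_symm] at this)
  -- extracting a covering pair for finitely many points of `H₁`
  have hpair : ∀ {k₀ : ℕ} (t : Fin k₀ → K), (∀ i, t i ∈ H₁) →
      ∃ (m : ℕ) (c : Fin m → K) (c' : Fin m → K'), IsGammaIsoTw₂ σ c c' ∧ (∀ l, ∃ i, c i = a l ∧ c' i = a' l) ∧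
        ∀ j, ∃ i, c i = t j ∧ c' i = g' (t j) := by
    intro k₀ t ht
    obtain ⟨n₀, x, y, hS₀, -, -, ι, hx, hy⟩ := hcov t ht
    obtain ⟨m', c, c', hiso, -, -, -, -, hia, hcv⟩ := hS₀
    refine ⟨m', c, c', hiso, hia, fun j => ?_⟩
    obtain ⟨i, hi, hi'⟩ := hcv (ι j)
    exact ⟨i, by rw [hi]; exact congrFun hx j, by rw [hi']; exact congrFun hy j⟩
  -- the closures are E-subfields
  have hHadd : ∀ {u v : K}, u ∈ (H₁ : Set K) → v ∈ (H₁ : Set K) → u + v ∈ (H₁ : Set K) := by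
    intro u v hu hv
    rw [SetLike.mem_coe, hmemH₁] at hu hv ⊢
    exact Khovanskii.add_mem_ecl hu hv
  have hHmul : ∀ {u v : K}, u ∈ (H₁ : Set K) → v ∈ (H₁ : Set K) → u * v ∈ (H₁ : Set K) := by
    intro u v hu hv
    rw [SetLike.mem_coe, hmemH₁] at hu hv ⊢
    exact Khovanskii.mul_mem_ecl hu hv
  have hHexp : ∀ {u : K}, u ∈ (H₁ : Set K) → exp u ∈ (H₁ : Set K) := by
    intro u hu
    rw [SetLike.mem_coe, hmemH₁] at hu ⊢
    exact Khovanskii.exp_mem_ecl hu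
  -- conclusion
  have hHset₁ : ((H₁ : Set K)) = ecl (S ∪ range a) := by rw [hH₁def, coe_span_ecl]
  have hHset₂ : ((H₂ : Set K')) = ecl (S' ∪ range a') := by rw [hH₂def, coe_span_ecl]
  refine ⟨g', ?_, ?_, ?_⟩
  · rw [← hHset₁, ← hHset₂]
    refine ⟨⟨?_, ?_, ?_⟩, ?_, ?_, ?_⟩
    · intro z hz
      rw [← himg]; exact mem_image_of_mem g' hz
    · intro p hp q hq hpq
      obtain ⟨m', c, c', hiso, -, hcv⟩ := hpair ![p, q] (fun i => by fin_cases i <;> assumption)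
      obtain ⟨i, hi, hi'⟩ := hcv 0
      obtain ⟨j, hj, hj'⟩ := hcv 1
      simp only [Matrix.cons_val_zero, Matrix.cons_val_one] at hi hi' hj hj'
      have := (hiso.apply_eq_iff i j).2 (by rw [hi', hj', hpq])
      rwa [hi, hj] at this
    · rw [← himg]; exact surjOn_image g' _
    · intro u v hu hv
      obtain ⟨m', c, c', hiso, -, hcv⟩ := hpair ![u, v, u + v]
        (fun i => by fin_cases i <;> [exact hu; exact hv; exact hHadd hu hv])
      obtain ⟨i, hi, hi'⟩ := hcv 0
      obtain ⟨j, hj, hj'⟩ := hcv 1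
      obtain ⟨k₃, hk, hk'⟩ := hcv 2
      simp only [Matrix.cons_val_zero, Matrix.cons_val_one, Matrix.head_cons, Matrix.cons_val_two,
        Matrix.tail_cons] at hi hi' hj hj' hk hk'
      have := add_eq hiso (i := i) (j := j) (k := k₃) (by rw [hi, hj, hk])
      rw [hi', hj', hk'] at this
      exact this.symm
    · intro u v hu hv
      obtain ⟨m', c, c', hiso, -, hcv⟩ := hpair ![u, v, u * v]
        (fun i => by fin_cases i <;> [exact hu; exact hv; exact hHmul hu hv])
      obtain ⟨i, hi, hi'⟩ := hcv 0
      obtain ⟨j, hj, hj'⟩ := hcv 1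
      obtain ⟨k₃, hk, hk'⟩ := hcv 2
      simp only [Matrix.cons_val_zero, Matrix.cons_val_one, Matrix.head_cons, Matrix.cons_val_two,
        Matrix.tail_cons] at hi hi' hj hj' hk hk'
      have := mul_eq hiso (i := i) (j := j) (k := k₃) (by rw [hi, hj, hk])
      rw [hi', hj', hk'] at this
      exact this.symm
    · intro u hu
      obtain ⟨m', c, c', hiso, -, hcv⟩ := hpair ![u, exp u]
        (fun i => by fin_cases i <;> [exact hu; exact hHexp hu])
      obtain ⟨i, hi, hi'⟩ := hcv 0
      obtain ⟨k₃, hk, hk'⟩ := hcv 1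
      simp only [Matrix.cons_val_zero, Matrix.cons_val_one] at hi hi' hk hk'
      have := exp_eq hiso (i := i) (k := k₃) (by rw [hi, hk])
      rw [hi', hk'] at this
      exact this.symm
  · -- `g' = g` on `ecl S`
    intro z hz
    have hzK : z ∈ K₁ := hmemK₁.2 hz
    obtain ⟨m', c, c', hiso, -, hcv⟩ := hpair ![z] (fun i => by fin_cases i; exact hKH₁ hzK)
    obtain ⟨i, hi, hi'⟩ := hcv 0
    simp only [Matrix.cons_val_zero] at hi hi'
    have hzF : z ∈ fieldOf K₁ := mem_fieldOf_of_mem hzK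
    have := hiso.eq_of_eq_coe (i := i) (k := ⟨z, hzF⟩) hi
    rw [hi'] at this
    rw [this, hσdef, coe_baseEquiv₂]
  · -- `g' a = a'`
    intro l
    obtain ⟨m', c, c', hiso, hia, hcv⟩ := hpair ![a l] (fun i => by fin_cases i; exact haH₁ l)
    obtain ⟨i₀, hi₀, hi₀'⟩ := hia l
    obtain ⟨i, hi, hi'⟩ := hcv 0
    simp only [Matrix.cons_val_zero] at hi hi'
    have := (hiso.apply_eq_iff i₀ i).1 (by rw [hi₀, hi])
    rw [hi₀', hi'] at this
    exact this.symm

/-- **Kirby 2010, Thm 2.1 across two Zilber fields.** For Zilber fields `K`, `K'` (of one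
universe), a countable `S ⊆ K`, an isomorphism of exponential fields `g : ecl^K(S) ≅ ecl^{K'}(S')`,
and `a ∉ ecl S`, `a' ∉ ecl S'`, the map `g ∪ {(a, a')}` extends to an isomorphism of exponential
fields `ecl^K(S ∪ {a}) ≅ ecl^{K'}(S' ∪ {a'})`: the generic points give a cross Γ-isomorphism
`(a) ↦ (a')` over the induced base isomorphism with strong spans
(`GammaField.IsGammaIsoTw₂.append_singleton_of_not_mem`, both generic over the Γ-closed `ecl S`,
`ecl S'`), and `exists_isEIsoOn₂_of_isGammaIsoTw₂` applies.
[cite: Kirby2010QMEC, Thm 2.1] [cite: BaysKirby2013Excellence, Prop. 4 and Prop. 5]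
[cite: BaysKirby2018ANT, Thm 9.1, Prop. 11.2] [cite: Zilber2005PseudoExp, §5 and Thm 5.13] -/
theorem _root_.Literature.NumberTheory.Transcendental.IsZilberField.eclIso_extension₂
    (hK : IsZilberField K) (hK' : IsZilberField K') {S : Set K} {S' : Set K'} (hS : S.Countable)
    {g : K → K'} (hg : IsEIsoOn₂ g (ecl S) (ecl S')) {a : K} {a' : K'} (ha : a ∉ ecl S) (ha' : a' ∉ ecl S') :
    ∃ g' : K → K', IsEIsoOn₂ g' (ecl (insert a S)) (ecl (insert a' S')) ∧
      EqOn g' g (ecl S) ∧ g' a = a' := by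
  set K₁ : Submodule ℚ K := Submodule.span ℚ (ecl S) with hK₁def
  set K₂ : Submodule ℚ K' := Submodule.span ℚ (ecl S') with hK₂def
  have hK₁ : IsGammaClosed K₁ := isGammaClosed_span_ecl_univ _
  have hK₂ : IsGammaClosed K₂ := isGammaClosed_span_ecl_univ _
  have haK₁ : a ∉ K₁ := fun h => ha (by rwa [← SetLike.mem_coe, hK₁def, coe_span_ecl] at h)
  have haK₂ : a' ∉ K₂ := fun h => ha' (by rwa [← SetLike.mem_coe, hK₂def, coe_span_ecl] at h)
  have h0 := isGammaIsoTw₂_elim0 (K := K) (K' := K') (baseEquiv₂ hg)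
  have he0 : range (Fin.elim0 : Fin 0 → K) = ∅ := Set.range_eq_empty _
  have he0' : range (Fin.elim0 : Fin 0 → K') = ∅ := Set.range_eq_empty _
  have hs₁ : IsStrong (K₁ ⊔ Submodule.span ℚ (range (Fin.elim0 : Fin 0 → K))) := by
    rw [he0, Submodule.span_empty, sup_bot_eq]; exact hK₁.isStrong
  have hs₂ : IsStrong (K₂ ⊔ Submodule.span ℚ (range (Fin.elim0 : Fin 0 → K'))) := by
    rw [he0', Submodule.span_empty, sup_bot_eq]; exact hK₂.isStrong
  obtain ⟨hγ, hst₁, hst₂⟩ := h0.append_singleton_of_not_mem hs₁ hs₂ hK₁ hK₂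
    (by rw [he0, Submodule.span_empty, sup_bot_eq])
    (by rw [he0', Submodule.span_empty, sup_bot_eq]) haK₁ haK₂
  rw [Fin.elim0_append, Fin.elim0_append] at hγ
  rw [Fin.elim0_append] at hst₁
  rw [Fin.elim0_append] at hst₂
  have hr : ∀ {X : Type u} (z : X), range (![z] ∘ Fin.cast (Nat.zero_add 1)) = {z} := by
    intro X z
    ext w
    simp only [mem_range, Function.comp_apply, mem_singleton_iff]
    constructor
    · rintro ⟨i, rfl⟩; simp
    · rintro rfl; exact ⟨0, by simp⟩
  obtain ⟨g', hg', hg'g, hg'a⟩ := exists_isEIsoOn₂_of_isGammaIsoTw₂ hK hK' hS hg hγ hst₁ hst₂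
  refine ⟨g', ?_, hg'g, ?_⟩
  · rwa [hr, hr, union_singleton, union_singleton] at hg'
  · have := hg'a 0
    simpa using this

end ZilberHomogeneity

end Literature.NumberTheory.Transcendental
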